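import Literature.Geometry.Symplectic.GromovR4StdModel

/-!
# The star-shaped model map `G(z) = e^{u(z/‖z‖)/2} z` of the Liouville collar

Helper file of stub `stub_liouvilleCollar` (line `kaehler-jacket`, crux stmt-SmoothPoincare4-7823).
For a smooth `u : ℝ⁴ → ℝ` the map `G z = e^{u(z/‖z‖)/2} z` is the radial diffeomorphism of
`ℝ⁴ ∖ 0` carrying the unit sphere onto the star-shaped hypersurface `Y = {e^{u(θ)/2} θ}` and the
rays onto the rays; it intertwines the Euler field `z` with itself (`DG_z z = G z`), and along the
unit sphere `ω₀(G θ, DG_θ w) = e^{u θ} ω₀(θ, w)` for `w ⊥ θ` — the identity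
`(θ ↦ ρ θ)^*λ₀ = ρ² α₀` (`λ₀ = ½ ω₀(y, dy)`, `α₀ = λ₀|S³`) of Geiges (2008), proof of Lemma 5.2.4,
read on tangent vectors.  Everything is elementary calculus (`helper_kjStarMap` packages:
smoothness off `0`, `DG_z z = G z`, the sphere identity, injectivity, injectivity of `DG_z`,
`‖G z‖ = e^{u/2} ‖z‖` and `G z/‖G z‖ = z/‖z‖`).

## References

* H. Geiges, *An Introduction to Contact Topology*, CUP 2008, Lemma 5.2.4. [Geiges2008]
-/

noncomputable section

set_option linter.dupNamespace false

open scoped Manifold ContDiff Topology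
open Set Function
open Literature.Geometry.Symplectic (stdSymplecticForm stdSymplecticBilin stdSymplecticBilin_apply
  stdSymplecticForm_self)

namespace Summit.SmoothPoincare4.SmoothPoincare4.Theorems.Target.KaehlerJacket

/-- Model space `ℝ⁴ = ℂ²`. -/
local notation "E4" => EuclideanSpace ℝ (Fin 4)

/-! ### The star map -/

section Star

variable {u : E4 → ℝ} {G : E4 → E4}

/-- The star map is smooth off the origin. [folklore] -/
theorem star_contDiffAt (hu : ContDiff ℝ ∞ u)
    (hG : ∀ z, G z = Real.exp (u (‖z‖⁻¹ • z) / 2) • z) {z : E4} (hz : z ≠ 0) :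
    ContDiffAt ℝ ∞ G z := by
  have hfun : G = fun z : E4 => Real.exp (u (‖z‖⁻¹ • z) / 2) • z := funext hG
  rw [hfun]
  have hN : ContDiffAt ℝ ∞ (fun z : E4 => ‖z‖⁻¹ • z) z :=
    ((contDiffAt_norm ℝ hz).inv (norm_ne_zero_iff.2 hz)).smul contDiffAt_id
  exact (((hu.contDiffAt.comp z hN).div_const 2).exp).smul contDiffAt_id

/-- `‖G z‖ = e^{u(z/‖z‖)/2} ‖z‖`. [folklore] -/
theorem star_norm (hG : ∀ z, G z = Real.exp (u (‖z‖⁻¹ • z) / 2) • z) (z : E4) :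
    ‖G z‖ = Real.exp (u (‖z‖⁻¹ • z) / 2) * ‖z‖ := by
  rw [hG, norm_smul, Real.norm_of_nonneg (Real.exp_pos _).le]

/-- `G` preserves rays: `G z/‖G z‖ = z/‖z‖`. [folklore] -/
theorem star_normalize (hG : ∀ z, G z = Real.exp (u (‖z‖⁻¹ • z) / 2) • z) (z : E4) :
    ‖G z‖⁻¹ • G z = ‖z‖⁻¹ • z := by
  rw [hG z, norm_smul, Real.norm_of_nonneg (Real.exp_pos _).le, smul_smul, mul_inv, mul_assoc,
    mul_comm ‖z‖⁻¹ (Real.exp _), ← mul_assoc, inv_mul_cancel₀ (Real.exp_pos _).ne', one_mul]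

/-- `G z ≠ 0` for `z ≠ 0`. [folklore] -/
theorem star_ne_zero (hG : ∀ z, G z = Real.exp (u (‖z‖⁻¹ • z) / 2) • z) {z : E4} (hz : z ≠ 0) :
    G z ≠ 0 := by
  rw [← norm_ne_zero_iff, star_norm hG]
  exact mul_ne_zero (Real.exp_pos _).ne' (norm_ne_zero_iff.2 hz)

/-- `G` is injective off the origin (it preserves rays and is strictly monotone on each).
[folklore] -/
theorem star_injective (hG : ∀ z, G z = Real.exp (u (‖z‖⁻¹ • z) / 2) • z) {z z' : E4}
    (hz : z ≠ 0) (hz' : z' ≠ 0) (h : G z = G z') : z = z' := by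
  have hray : ‖z‖⁻¹ • z = ‖z'‖⁻¹ • z' := by
    rw [← star_normalize hG z, ← star_normalize hG z', h]
  have hnorm : ‖z‖ = ‖z'‖ := by
    have h1 := star_norm hG z
    have h2 := star_norm hG z'
    rw [h, hray] at h1
    exact mul_left_cancel₀ (Real.exp_pos _).ne' (h1.symm.trans h2)
  have hzz : z = ‖z‖ • (‖z‖⁻¹ • z) := by
    rw [smul_smul, mul_inv_cancel₀ (norm_ne_zero_iff.2 hz), one_smul]
  have hzz' : z' = ‖z'‖ • (‖z'‖⁻¹ • z') := by
    rw [smul_smul, mul_inv_cancel₀ (norm_ne_zero_iff.2 hz'), one_smul]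
  calc z = ‖z‖ • (‖z‖⁻¹ • z) := hzz
    _ = ‖z'‖ • (‖z'‖⁻¹ • z') := by rw [hray, hnorm]
    _ = z' := hzz'.symm

/-- The inverse star map `w ↦ e^{-u(w/‖w‖)/2} w` is a left inverse of `G` off the origin.
[folklore] -/
theorem star_leftInverse (hG : ∀ z, G z = Real.exp (u (‖z‖⁻¹ • z) / 2) • z) {z : E4} :
    Real.exp (-(u (‖G z‖⁻¹ • G z) / 2)) • G z = z := by
  rw [star_normalize hG z, hG z, smul_smul, ← Real.exp_add, neg_add_cancel, Real.exp_zero,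
    one_smul]

/-- The differential of `G` at `z ≠ 0` is injective (`G` has a differentiable left inverse).
[folklore] -/
theorem star_fderiv_injective (hu : ContDiff ℝ ∞ u)
    (hG : ∀ z, G z = Real.exp (u (‖z‖⁻¹ • z) / 2) • z) {z : E4} (hz : z ≠ 0) :
    Injective (fderiv ℝ G z) := by
  set H : E4 → E4 := fun w => Real.exp (-(u (‖w‖⁻¹ • w) / 2)) • w with hH_def
  have hHd : DifferentiableAt ℝ H (G z) := by
    have hGz : G z ≠ 0 := star_ne_zero hG hz
    have hN : ContDiffAt ℝ ∞ (fun w : E4 => ‖w‖⁻¹ • w) (G z) :=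
      ((contDiffAt_norm ℝ hGz).inv (norm_ne_zero_iff.2 hGz)).smul contDiffAt_id
    exact ((((hu.contDiffAt.comp (G z) hN).div_const 2).neg.exp).smul
      contDiffAt_id).differentiableAt (by simp)
  have hGd : DifferentiableAt ℝ G z := (star_contDiffAt hu hG hz).differentiableAt (by simp)
  have hev : H ∘ G =ᶠ[𝓝 z] id := by
    filter_upwards [isOpen_compl_singleton.mem_nhds hz] with w _
    exact star_leftInverse hG
  have hid : fderiv ℝ (H ∘ G) z = ContinuousLinearMap.id ℝ E4 := by
    rw [hev.fderiv_eq, fderiv_id]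
  have hcomp : fderiv ℝ (H ∘ G) z = (fderiv ℝ H (G z)).comp (fderiv ℝ G z) := fderiv_comp z hHd hGd
  intro v w hvw
  have h1 : (fderiv ℝ H (G z)).comp (fderiv ℝ G z) v =
      (fderiv ℝ H (G z)).comp (fderiv ℝ G z) w := by
    simp only [ContinuousLinearMap.coe_comp, comp_apply, hvw]
  rwa [← hcomp, hid, ContinuousLinearMap.coe_id', id_eq, id_eq] at h1

/-- `G` commutes with positive rescaling: `G (e^s z) = e^s G z`. [folklore] -/
theorem star_smul_exp (hG : ∀ z, G z = Real.exp (u (‖z‖⁻¹ • z) / 2) • z) (z : E4) (s : ℝ) :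
    G (Real.exp s • z) = Real.exp s • G z := by
  have hdir : ‖Real.exp s • z‖⁻¹ • (Real.exp s • z) = ‖z‖⁻¹ • z := by
    rw [norm_smul, Real.norm_of_nonneg (Real.exp_pos s).le, smul_smul, mul_inv, mul_assoc,
      mul_comm ‖z‖⁻¹ (Real.exp s), ← mul_assoc, inv_mul_cancel₀ (Real.exp_pos s).ne', one_mul]
  rw [hG, hG z, hdir, smul_comm]

/-- **Euler identity for the star map**: `DG_z z = G z` (`G` is homogeneous of degree one
along rays). [folklore] -/
theorem star_fderiv_self (hu : ContDiff ℝ ∞ u)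
    (hG : ∀ z, G z = Real.exp (u (‖z‖⁻¹ • z) / 2) • z) {z : E4} (hz : z ≠ 0) :
    fderiv ℝ G z z = G z := by
  -- the curve `γ s = e^s z` has `γ 0 = z`, `γ' 0 = z`, and `G ∘ γ = e^s G z`
  have hγ : HasDerivAt (fun s : ℝ => Real.exp s • z) (Real.exp 0 • z) 0 :=
    (Real.hasDerivAt_exp 0).smul_const z
  have hγ0 : Real.exp 0 • z = z := by rw [Real.exp_zero, one_smul]
  rw [hγ0] at hγ
  have hGd : HasFDerivAt G (fderiv ℝ G z) (Real.exp 0 • z) := by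
    rw [hγ0]
    exact ((star_contDiffAt hu hG hz).differentiableAt (by simp)).hasFDerivAt
  have h1 : HasDerivAt (G ∘ fun s : ℝ => Real.exp s • z) (fderiv ℝ G z z) 0 :=
    hGd.comp_hasDerivAt 0 hγ
  have h2 : HasDerivAt (G ∘ fun s : ℝ => Real.exp s • z) (Real.exp 0 • G z) 0 := by
    have : (G ∘ fun s : ℝ => Real.exp s • z) = fun s => Real.exp s • G z :=
      funext fun s => star_smul_exp hG z s
    rw [this]
    exact (Real.hasDerivAt_exp 0).smul_const (G z)
  rw [Real.exp_zero, one_smul] at h2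
  exact h1.unique h2

/-- The great circle `s ↦ cos s θ + sin s ŵ` through orthonormal `θ, ŵ` stays on the unit sphere.
[folklore] -/
theorem norm_cos_smul_add_sin_smul {θ ŵ : E4} (hθ : ‖θ‖ = 1) (hŵ : ‖ŵ‖ = 1)
    (horth : inner ℝ ŵ θ = 0) (s : ℝ) : ‖Real.cos s • θ + Real.sin s • ŵ‖ = 1 := by
  have h2 : ‖Real.cos s • θ + Real.sin s • ŵ‖ ^ 2 = 1 := by
    rw [norm_add_sq_real, norm_smul, norm_smul, hθ, hŵ, real_inner_smul_left,
      real_inner_smul_right, real_inner_comm, horth, Real.norm_eq_abs, Real.norm_eq_abs, mul_one,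
      mul_one, sq_abs, sq_abs, mul_zero, mul_zero, mul_zero, add_zero, Real.cos_sq_add_sin_sq]
  have h0 : 0 ≤ ‖Real.cos s • θ + Real.sin s • ŵ‖ := norm_nonneg _
  nlinarith [h2, h0]

/-- **The star map on vectors tangent to the unit sphere**: for `‖θ‖ = 1` and `w ⊥ θ`,
`ω₀(G θ, DG_θ w) = e^{u θ} ω₀(θ, w)` — the identity `(θ ↦ e^{u/2} θ)^*λ₀ = e^{u} α₀` on `TS³`.
[cite: Geiges2008, Lemma 5.2.4] -/
theorem star_symplectic_tangent (hu : ContDiff ℝ ∞ u)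
    (hG : ∀ z, G z = Real.exp (u (‖z‖⁻¹ • z) / 2) • z) {θ : E4} (hθ : ‖θ‖ = 1) (w : E4)
    (hw : inner ℝ w θ = 0) :
    stdSymplecticForm (G θ) (fderiv ℝ G θ w) = Real.exp (u θ) * stdSymplecticForm θ w := by
  have hθ0 : θ ≠ 0 := by
    rw [← norm_ne_zero_iff, hθ]; exact one_ne_zero
  have hGθ : G θ = Real.exp (u θ / 2) • θ := by rw [hG, hθ, inv_one, one_smul]
  -- reduce to a unit tangent vector
  by_cases hw0 : w = 0
  · subst hw0
    simp only [map_zero, ← stdSymplecticBilin_apply, mul_zero]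
  set ŵ : E4 := ‖w‖⁻¹ • w with hŵ_def
  have hŵ1 : ‖ŵ‖ = 1 := by
    rw [norm_smul, norm_inv, norm_norm, inv_mul_cancel₀ (norm_ne_zero_iff.2 hw0)]
  have hŵθ : inner ℝ ŵ θ = 0 := by rw [hŵ_def, real_inner_smul_left, hw, mul_zero]
  have hwŵ : w = ‖w‖ • ŵ := by
    rw [hŵ_def, smul_smul, mul_inv_cancel₀ (norm_ne_zero_iff.2 hw0), one_smul]
  -- the great circle `γ` and `G ∘ γ = e^{u ∘ γ / 2} γ`
  set γ : ℝ → E4 := fun s => Real.cos s • θ + Real.sin s • ŵ with hγ_def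
  have hγ1 : ∀ s, ‖γ s‖ = 1 := norm_cos_smul_add_sin_smul hθ hŵ1 hŵθ
  have hγ0 : γ 0 = θ := by simp [hγ_def]
  have hGγ : G ∘ γ = fun s => Real.exp (u (γ s) / 2) • γ s := by
    funext s
    simp only [comp_apply]
    rw [hG, hγ1 s, inv_one, one_smul]
  have hdγ : HasDerivAt γ ŵ 0 := by
    have h := ((Real.hasDerivAt_cos 0).smul_const θ).add ((Real.hasDerivAt_sin 0).smul_const ŵ)
    simp only [Real.sin_zero, neg_zero, zero_smul, Real.cos_zero, one_smul, zero_add] at h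
    exact h
  have hγd : DifferentiableAt ℝ γ 0 := hdγ.differentiableAt
  have hf : DifferentiableAt ℝ (fun s => Real.exp (u (γ s) / 2)) 0 :=
    (((hu.differentiable (by simp)).differentiableAt.comp 0 hγd).div_const 2).exp
  set κ : ℝ := deriv (fun s => Real.exp (u (γ s) / 2)) 0 with hκ_def
  have h2 : HasDerivAt (G ∘ γ) (Real.exp (u (γ 0) / 2) • ŵ + κ • γ 0) 0 := by
    rw [hGγ]
    exact hf.hasDerivAt.smul hdγ
  rw [hγ0] at h2
  have hGd : HasFDerivAt G (fderiv ℝ G θ) (γ 0) := by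
    rw [hγ0]
    exact ((star_contDiffAt hu hG hθ0).differentiableAt (by simp)).hasFDerivAt
  have h1 : HasDerivAt (G ∘ γ) (fderiv ℝ G θ ŵ) 0 := hGd.comp_hasDerivAt 0 hdγ
  have hDG : fderiv ℝ G θ ŵ = Real.exp (u θ / 2) • ŵ + κ • θ := h1.unique h2
  -- evaluate `ω₀(G θ, DG_θ w)`
  rw [hwŵ, map_smul, hDG, hGθ]
  simp only [← stdSymplecticBilin_apply, map_add, map_smul, smul_eq_mul, smul_apply]
  rw [stdSymplecticBilin_apply θ θ, stdSymplecticForm_self, mul_zero, mul_zero, add_zero,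
    ← mul_assoc (Real.exp _), ← Real.exp_add, add_halves]
  ring

end Star

/-- **The star-shaped model map of the Liouville collar** (`helper_kjStarMap`).  For a smooth
`u : ℝ⁴ → ℝ`, the map `G z = e^{u(z/‖z‖)/2} z` is smooth off the origin, satisfies the Euler
identity `DG_z z = G z`, and on the unit sphere `ω₀(G θ, DG_θ w) = e^{u θ} ω₀(θ, w)` for
`w ⊥ θ` (the computation `(θ ↦ ρθ)^*λ₀ = ρ² α₀` of Geiges (2008), proof of Lemma 5.2.4); it is
injective off the origin with injective differential, `‖G z‖ = e^{u(z/‖z‖)/2} ‖z‖` and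
`G z/‖G z‖ = z/‖z‖`. [cite: Geiges2008, Lemma 5.2.4] -/
theorem helper_kjStarMap :
    ∀ (u : E4 → ℝ) (G : E4 → E4), ContDiff ℝ ∞ u →
      (∀ z, G z = Real.exp (u (‖z‖⁻¹ • z) / 2) • z) →
      (∀ z : E4, z ≠ 0 → ContDiffAt ℝ ∞ G z) ∧
      (∀ z : E4, z ≠ 0 → fderiv ℝ G z z = G z) ∧
      (∀ θ : E4, ‖θ‖ = 1 → ∀ w : E4, inner ℝ w θ = 0 →
        stdSymplecticForm (G θ) (fderiv ℝ G θ w) = Real.exp (u θ) * stdSymplecticForm θ w) ∧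
      (∀ z z' : E4, z ≠ 0 → z' ≠ 0 → G z = G z' → z = z') ∧
      (∀ z : E4, z ≠ 0 → Injective (fderiv ℝ G z)) ∧
      (∀ z : E4, ‖G z‖ = Real.exp (u (‖z‖⁻¹ • z) / 2) * ‖z‖ ∧ ‖G z‖⁻¹ • G z = ‖z‖⁻¹ • z) := by
  intro u G hu hG
  exact ⟨fun z hz => star_contDiffAt hu hG hz, fun z hz => star_fderiv_self hu hG hz,
    fun θ hθ w hw => star_symplectic_tangent hu hG hθ w hw,
    fun z z' hz hz' h => star_injective hG hz hz' h, fun z hz => star_fderiv_injective hu hG hz,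
    fun z => ⟨star_norm hG z, star_normalize hG z⟩⟩

end Summit.SmoothPoincare4.SmoothPoincare4.Theorems.Target.KaehlerJacket

end
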